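import Literature.NumberTheory.Transcendental.KZCalculus
import Literature.NumberTheory.Transcendental.KZSubcalculusInvariants
import Literature.NumberTheory.Transcendental.SemialgebraicMapsProofs
import Literature.NumberTheory.Transcendental.KZSemiCanonicalReductionProofs
import Literature.Barriers.KontsevichZagierPeriods.AlgebraicPrimitivesObstruction
import Mathlib.MeasureTheory.Measure.Lebesgue.Integral
import Mathlib.Analysis.SpecialFunctions.Integrals.Basic

/-!
# `OffTetraSectorKernel` (stmt-KontsevichZagierPeriods-10557) — negative side: the slice invariant, part 1 (core)

Part 1 of 3 (`SliceCore` ⊂ `SliceInvariant` ⊂ `SliceWitness`); the mathematical summary of the whole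
development is in the module docstring of `SliceWitness.lean`. This part: the analytic core of rule (3)
for raw data (`setIntegral_band_eq_of_hasDerivAt`: Fubini along the last coordinate + FTC on the
fibres), the slice windows `{y₀ ≤ x}` and the slice map `sliceFun : FormalRep →+ (ℝ → ℝ)`, its
invariance under the additivity moves and under rule (3) over a base of positive dimension, the
subgroup `semialgFun` of `ℚ`-semialgebraic functions of one variable, and semialgebraic bookkeeping on
the line (half-lines and constants from semialgebraic points; Tarski–Seidenberg). cdisprove (refuter)
file; sorry-free; axioms ⊆ {propext, Classical.choice, Quot.sound}.
[Kontsevich–Zagier 2001, §1.2, rules (1)–(3); Bochnak–Coste–Roy 1998, §2.2]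
-/


noncomputable section

open MeasureTheory Set Filter


open Literature.NumberTheory.Transcendental Literature.NumberTheory.Transcendental.KZ

namespace Summit.KontsevichZagierPeriods.HyperbolicBloch.OffTetraSectorKernelNegative


variable {n : ℕ}

/-! ### The analytic core of rule (3), for raw data -/

/-- Fubini along the last coordinate + FTC on each fibre, for raw data (no semialgebraicity):
the computation inside `eval_eq_zero_of_mem_newtonLeibnizRel_holds`. [folklore] -/
theorem setIntegral_band_eq_of_hasDerivAt {D : Set (Fin (n + 1) → ℝ)} {τ : Set (Fin n → ℝ)}
    {f : (Fin (n + 1) → ℝ) → ℝ} {g : (Fin n → ℝ) → ℝ} {a b : (Fin n → ℝ) → ℝ}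
    {F : (Fin (n + 1) → ℝ) → ℝ} (hτm : MeasurableSet τ) (hDm : MeasurableSet D)
    (hint : IntegrableOn f D) (hab : ∀ x ∈ τ, a x ≤ b x)
    (hdom : D = {z | (Fin.init z : Fin n → ℝ) ∈ τ ∧ a (Fin.init z) ≤ z (Fin.last n) ∧
      z (Fin.last n) ≤ b (Fin.init z)})
    (hcont : ∀ x ∈ τ, ContinuousOn (fun t : ℝ => F (Fin.snoc x t)) (Icc (a x) (b x)))
    (hderiv : ∀ x ∈ τ, ∀ t ∈ Ioo (a x) (b x),
      HasDerivAt (fun s : ℝ => F (Fin.snoc x s)) (f (Fin.snoc x t)) t)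
    (hg : ∀ x ∈ τ, g x = F (Fin.snoc x (b x)) - F (Fin.snoc x (a x))) :
    ∫ z in D, f z = ∫ x in τ, g x := by
  set e : (Fin (n + 1) → ℝ) ≃ᵐ ℝ × (Fin n → ℝ) :=
    MeasurableEquiv.piFinSuccAbove (fun _ => ℝ) (Fin.last n) with he_def
  have he : MeasurePreserving e volume volume :=
    volume_preserving_piFinSuccAbove (fun _ => ℝ) (Fin.last n)
  have he_symm : ∀ p : ℝ × (Fin n → ℝ), e.symm p = Fin.snoc p.2 p.1 := fun p => by
    simp [he_def, MeasurableEquiv.piFinSuccAbove, Fin.snocEquiv]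
  have hmem : ∀ x t, Fin.snoc x t ∈ D ↔ x ∈ τ ∧ t ∈ Icc (a x) (b x) := by
    intro x t
    rw [hdom]
    simp only [mem_setOf_eq, Fin.init_snoc, Fin.snoc_last, mem_Icc]
  set G : (Fin (n + 1) → ℝ) → ℝ := D.indicator f with hG_def
  have hG : Integrable G := (integrable_indicator_iff hDm).mpr hint
  have hfib_in : ∀ x ∈ τ, (fun t => G (Fin.snoc x t)) =
      (Icc (a x) (b x)).indicator (fun t => f (Fin.snoc x t)) := by
    intro x hx
    ext t
    by_cases ht : t ∈ Icc (a x) (b x)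
    · rw [Set.indicator_of_mem ht, hG_def, Set.indicator_of_mem ((hmem x t).2 ⟨hx, ht⟩)]
    · rw [Set.indicator_of_notMem ht, hG_def,
        Set.indicator_of_notMem (fun h => ht ((hmem x t).1 h).2)]
  have hfib_out : ∀ x ∉ τ, (fun t => G (Fin.snoc x t)) = fun _ => 0 := by
    intro x hx
    ext t
    rw [hG_def, Set.indicator_of_notMem (fun h => hx ((hmem x t).1 h).1)]
  have hG2 : Integrable (fun p : ℝ × (Fin n → ℝ) => G (Fin.snoc p.2 p.1))
      ((volume : Measure ℝ).prod (volume : Measure (Fin n → ℝ))) := by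
    have h := ((he.symm e).integrable_comp_emb e.symm.measurableEmbedding (g := G)).mpr hG
    rw [← Measure.volume_eq_prod]
    convert h using 1
    ext p
    simp [he_symm]
  calc ∫ z in D, f z
      = ∫ z, G z := (integral_indicator hDm).symm
    _ = ∫ p, G (e.symm p) := ((he.symm e).integral_comp' G).symm
    _ = ∫ p : ℝ × (Fin n → ℝ), G (Fin.snoc p.2 p.1) ∂(volume.prod volume) := by
        simp_rw [he_symm, Measure.volume_eq_prod]
    _ = ∫ x, ∫ t, G (Fin.snoc x t) := integral_prod_symm _ hG2
    _ = ∫ x, τ.indicator (fun x => F (Fin.snoc x (b x)) - F (Fin.snoc x (a x))) x := by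
        apply integral_congr_ae
        filter_upwards [hG2.prod_left_ae] with x hx
        by_cases hxτ : x ∈ τ
        · rw [Set.indicator_of_mem hxτ, hfib_in x hxτ, integral_indicator measurableSet_Icc,
            integral_Icc_eq_integral_Ioc, ← intervalIntegral.integral_of_le (hab x hxτ)]
          apply intervalIntegral.integral_eq_sub_of_hasDerivAt_of_le (hab x hxτ) (hcont x hxτ)
            (hderiv x hxτ)
          rw [intervalIntegrable_iff_integrableOn_Icc_of_le (hab x hxτ)]
          have hx' : Integrable (fun t => G (Fin.snoc x t)) := hx
          rw [hfib_in x hxτ] at hx'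
          exact (integrable_indicator_iff measurableSet_Icc).mp hx'
        · rw [Set.indicator_of_notMem hxτ]
          rw [hfib_out x hxτ, integral_zero]
    _ = ∫ x in τ, (F (Fin.snoc x (b x)) - F (Fin.snoc x (a x))) := integral_indicator hτm
    _ = ∫ x in τ, g x := (setIntegral_congr_fun hτm fun x hx => hg x hx).symm

/-! ### The slice windows and the slice map -/

/-- The slice window at abscissa `x`: empty in dimension `0`, the half-space `{y₀ ≤ x}` in
positive dimension. [folklore] -/
def sliceWindow (x : ℝ) : (n : ℕ) → Set (Fin n → ℝ)
  | 0 => ∅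
  | _ + 1 => {y | y 0 ≤ x}

/-- The slice window in dimension `0` is empty. [folklore] -/
@[simp] theorem sliceWindow_zero (x : ℝ) : sliceWindow x 0 = ∅ := rfl

/-- The slice window in positive dimension is the half-space `{y₀ ≤ x}`. [folklore] -/
@[simp] theorem sliceWindow_succ (x : ℝ) (m : ℕ) :
    sliceWindow x (m + 1) = {y : Fin (m + 1) → ℝ | y 0 ≤ x} := rfl

/-- Slice windows are measurable. [folklore] -/
theorem measurableSet_sliceWindow (x : ℝ) : ∀ n, MeasurableSet (sliceWindow x n)
  | 0 => MeasurableSet.empty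
  | _ + 1 => measurableSet_le (measurable_pi_apply 0) measurable_const

/-- **The slice map**: `[r] ↦ (x ↦ ∫_{σ ∩ {y₀ ≤ x}} f)` (and `0` in dimension `0`), additively
extended; pointwise it is `KZ.restrictedEval (sliceWindow x)`. [folklore] -/
def sliceFun : FormalRep →+ (ℝ → ℝ) where
  toFun c x := restrictedEval (sliceWindow x) c
  map_zero' := by ext x; simp
  map_add' c d := by ext x; simp

/-- Pointwise, the slice map is a restricted evaluation. [folklore] -/
theorem sliceFun_apply (c : FormalRep) (x : ℝ) :
    sliceFun c x = restrictedEval (sliceWindow x) c := rfl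

/-- The slice map on a generator. [folklore] -/
@[simp] theorem sliceFun_of (r : IntegralRep n) (x : ℝ) :
    sliceFun (of r) x = ∫ y in r.domain ∩ sliceWindow x n, r.integrand y := by
  rw [sliceFun_apply, restrictedEval_of]

/-- The additivity moves (1a), (1b) preserve the slice map. [folklore] -/
theorem sliceFun_eq_zero_of_mem_add {c : FormalRep} (hc : c ∈ domainAddRel ∪ integrandAddRel) :
    sliceFun c = 0 := by
  ext x
  rw [sliceFun_apply, Pi.zero_apply]
  rcases hc with hc | hc
  · exact restrictedEval_eq_zero_of_mem_domainAddRel _ (measurableSet_sliceWindow x) hc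
  · exact restrictedEval_eq_zero_of_mem_integrandAddRel _ (measurableSet_sliceWindow x) hc

/-- **Rule (3) over a base of POSITIVE dimension preserves the slice map**: the slice window is a
cylinder over the base window, so the windowed pair is again a band over a (windowed) base and the
analytic core applies verbatim. [folklore] -/
theorem sliceFun_eq_zero_of_nl_succ {m : ℕ} (r : IntegralRep (m + 1 + 1)) (r' : IntegralRep (m + 1))
    (a b : (Fin (m + 1) → ℝ) → ℝ) (F : (Fin (m + 1 + 1) → ℝ) → ℝ)
    (hab : ∀ x ∈ r'.domain, a x ≤ b x)
    (hdom : r.domain = {z | (Fin.init z : Fin (m + 1) → ℝ) ∈ r'.domain ∧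
      a (Fin.init z) ≤ z (Fin.last (m + 1)) ∧ z (Fin.last (m + 1)) ≤ b (Fin.init z)})
    (hcont : ∀ x ∈ r'.domain, ContinuousOn (fun t : ℝ => F (Fin.snoc x t)) (Icc (a x) (b x)))
    (hderiv : ∀ x ∈ r'.domain, ∀ t ∈ Ioo (a x) (b x),
      HasDerivAt (fun s : ℝ => F (Fin.snoc x s)) (r.integrand (Fin.snoc x t)) t)
    (hr' : ∀ x ∈ r'.domain, r'.integrand x = F (Fin.snoc x (b x)) - F (Fin.snoc x (a x))) :
    sliceFun (of r - of r') = 0 := by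
  ext x
  rw [map_sub, Pi.sub_apply, sliceFun_of, sliceFun_of, Pi.zero_apply, sub_eq_zero,
    sliceWindow_succ, sliceWindow_succ]
  have hτm : MeasurableSet r'.domain := IntegralRep.measurableSet_domain_holds r'
  have hDm : MeasurableSet r.domain := IntegralRep.measurableSet_domain_holds r
  have hW : MeasurableSet {y : Fin (m + 1) → ℝ | y 0 ≤ x} := measurableSet_sliceWindow x (m + 1)
  have hW' : MeasurableSet {z : Fin (m + 1 + 1) → ℝ | z 0 ≤ x} :=
    measurableSet_sliceWindow x (m + 1 + 1)
  refine setIntegral_band_eq_of_hasDerivAt (τ := r'.domain ∩ {y | y 0 ≤ x}) (a := a) (b := b)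
    (F := F) (hτm.inter hW) (hDm.inter hW') (r.integrableOn.mono_set inter_subset_left)
    (fun y hy => hab y hy.1) ?_ (fun y hy => hcont y hy.1) (fun y hy => hderiv y hy.1)
    (fun y hy => hr' y hy.1)
  ext z
  rw [hdom]
  simp only [mem_inter_iff, mem_setOf_eq]
  have h0 : (Fin.init z : Fin (m + 1) → ℝ) 0 = z 0 := by
    simp [Fin.init]
  rw [h0]
  tauto


/-! ### `ℚ`-semialgebraic functions of one variable, as a subgroup of `ℝ → ℝ` -/

open Literature.ModelTheory.ExponentialFields (IsSemialgebraic isSemialgebraic_univ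
  isSemialgebraic_empty tarski_seidenberg_real_holds)

/-- The additive group of functions `g : ℝ → ℝ` which are `ℚ`-semialgebraic (as functions on
`ℝ¹`). [folklore] -/
def semialgFun : AddSubgroup (ℝ → ℝ) where
  carrier := {g | IsSemialgebraicFunOn ℚ (univ : Set (Fin 1 → ℝ)) (fun t => g (t 0))}
  zero_mem' := by
    change IsSemialgebraicFunOn ℚ univ (fun t : Fin 1 → ℝ => (0 : ℝ → ℝ) (t 0))
    simpa using isSemialgebraicFunOn_natCast (m := 1) (R := ℝ) (k := ℚ) isSemialgebraic_univ 0
  add_mem' {f g} hf hg := IsSemialgebraicFunOn.add_holds hf hg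
  neg_mem' {f} hf := IsSemialgebraicFunOn.neg hf

/-- Membership in `semialgFun`, unfolded. [folklore] -/
theorem mem_semialgFun {g : ℝ → ℝ} :
    g ∈ semialgFun ↔ IsSemialgebraicFunOn ℚ (univ : Set (Fin 1 → ℝ)) (fun t => g (t 0)) :=
  Iff.rfl

/-! ### Semialgebraic bookkeeping on the line -/

/-- From a `ℚ`-semialgebraic point `{t | t₀ = A}` to the half-line `{t | t₀ < A}`
(project `{(t, s) | s = A, t < s}`; Tarski–Seidenberg). [folklore] -/
theorem isSemialgebraic_setOf_lt_of_eq {A : ℝ} (hA : IsSemialgebraic ℚ {z : Fin 1 → ℝ | z 0 = A}) :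
    IsSemialgebraic ℚ {z : Fin 1 → ℝ | z 0 < A} := by
  have h1 : IsSemialgebraic ℚ ((fun w : Fin 2 → ℝ => w ∘ (fun _ : Fin 1 => (1 : Fin 2))) ⁻¹'
      {z : Fin 1 → ℝ | z 0 = A}) := hA.preimage_comp _
  have h2 : IsSemialgebraic ℚ {w : Fin 2 → ℝ | MvPolynomial.aeval w (MvPolynomial.X 0 : MvPolynomial (Fin 2) ℚ) <
      MvPolynomial.aeval w (MvPolynomial.X 1 : MvPolynomial (Fin 2) ℚ)} :=
    Literature.ModelTheory.ExponentialFields.isSemialgebraic_setOf_eval_lt _ _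
  have h3 := (h1.inter h2).image_comp (fun _ : Fin 1 => (0 : Fin 2))
  convert h3 using 1
  ext t
  simp only [mem_setOf_eq, mem_image, mem_inter_iff, mem_preimage, Function.comp_def,
    MvPolynomial.aeval_X]
  constructor
  · intro ht
    refine ⟨![t 0, A], ⟨by simp, by simpa using ht⟩, ?_⟩
    funext i
    fin_cases i
    simp
  · rintro ⟨w, ⟨hw1, hw2⟩, rfl⟩
    rw [hw1] at hw2
    exact hw2

/-- … and to `{t | t₀ ≤ A}`. [folklore] -/
theorem isSemialgebraic_setOf_le_of_eq {A : ℝ} (hA : IsSemialgebraic ℚ {z : Fin 1 → ℝ | z 0 = A}) :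
    IsSemialgebraic ℚ {z : Fin 1 → ℝ | z 0 ≤ A} := by
  convert (isSemialgebraic_setOf_lt_of_eq hA).union hA using 1
  ext t
  simp [le_iff_lt_or_eq]

/-- … and to `{t | A < t₀}`, `{t | A ≤ t₀}`. [folklore] -/
theorem isSemialgebraic_setOf_gt_of_eq {A : ℝ} (hA : IsSemialgebraic ℚ {z : Fin 1 → ℝ | z 0 = A}) :
    IsSemialgebraic ℚ {z : Fin 1 → ℝ | A < z 0} := by
  convert (isSemialgebraic_setOf_le_of_eq hA).compl using 1
  ext t
  simp

/-- … and to `{t | A ≤ t₀}`. [cite: BochnakCosteRoy1998, §2.2] -/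
theorem isSemialgebraic_setOf_ge_of_eq {A : ℝ} (hA : IsSemialgebraic ℚ {z : Fin 1 → ℝ | z 0 = A}) :
    IsSemialgebraic ℚ {z : Fin 1 → ℝ | A ≤ z 0} := by
  convert (isSemialgebraic_setOf_lt_of_eq hA).compl using 1
  ext t
  simp

/-- A constant function whose value is a `ℚ`-semialgebraic point is `ℚ`-semialgebraic on every
`ℚ`-semialgebraic set. [folklore] -/
theorem isSemialgebraicFunOn_const_of_eq {m : ℕ} {s : Set (Fin m → ℝ)} (hs : IsSemialgebraic ℚ s)
    {c : ℝ} (hc : IsSemialgebraic ℚ {z : Fin 1 → ℝ | z 0 = c}) :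
    IsSemialgebraicFunOn ℚ s (fun _ => c) := by
  rw [isSemialgebraicFunOn_iff]
  have h := hs.setOf_init_mem.inter (hc.preimage_comp (fun _ : Fin 1 => Fin.last m))
  convert h using 1
  ext z
  simp [Function.comp_def]

/-- The value of a `ℚ`-semialgebraic function of one variable at a `ℚ`-semialgebraic point is a
`ℚ`-semialgebraic point (image of a point under a semialgebraic map). [folklore] -/
theorem isSemialgebraic_setOf_eq_apply {s : Set (Fin 1 → ℝ)} {F : (Fin 1 → ℝ) → ℝ}
    (hF : IsSemialgebraicFunOn ℚ s F) {A : ℝ} (hA : IsSemialgebraic ℚ {z : Fin 1 → ℝ | z 0 = A})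
    (hAs : (fun _ => A) ∈ s) : IsSemialgebraic ℚ {z : Fin 1 → ℝ | z 0 = F (fun _ => A)} := by
  have hs : IsSemialgebraic ℚ s := IsSemialgebraicFunOn.isSemialgebraic_holds hF
  have hmap : IsSemialgebraicMapOn ℚ s (fun t => (fun _ : Fin 1 => F t)) :=
    IsSemialgebraicMapOn.of_forall hs fun _ => hF
  have hsub : {z : Fin 1 → ℝ | z 0 = A} ⊆ s := by
    intro z hz
    have : z = fun _ => A := by
      funext i
      rw [Subsingleton.elim i 0]
      exact hz
    rw [this]
    exact hAs
  convert IsSemialgebraicMapOn.isSemialgebraic_image_holds hmap hsub hA using 1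
  ext z
  simp only [mem_setOf_eq, mem_image]
  constructor
  · intro hz
    refine ⟨fun _ => A, rfl, ?_⟩
    funext i
    rw [Subsingleton.elim i 0, hz]
  · rintro ⟨w, hw, rfl⟩
    have : w = fun _ => A := by
      funext i
      rw [Subsingleton.elim i 0]
      exact hw
    rw [this]



end Summit.KontsevichZagierPeriods.HyperbolicBloch.OffTetraSectorKernelNegative
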